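import Summits.QuantumFields.YangMills.Theorems.BalabanLadderUVSeamRecPolymerCarrier
import HarnessLib

/-!
# Crux `UVSeamRec` (stmt-QuantumFields-20043), v5(α) stub `stub_responseMomentsOdd6` (RM): the POLYMER DATA of the tempered
# architecture, VI — the shell's coefficient mass PER LEVEL is bounded uniformly in the radius AND the level (`≤ 1536`), so the
# density budget of the multiscale large-field carrier is `W ≤ 1536·Σ_{k≤kmax} w_k`

Helper file (`--supports stmt-QuantumFields-20043 --as helper`) of the unit `ym-20043-tempered-d1` (gen 1); sequel of
`…PolymerCarrier.lean` (III: `card_shell_le`, `coeffMass_le` — a count uniform in the centre but growing like `(4R+5)⁴` — and the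
`R`-uniform level-`0` budget `coeffMass_zero_le`).  This file proves the SCALE-INVARIANT form that ceilings-p2 g2's budget audit uses
(note `LANE-B-g2-CARRIERS-AND-COMPONENTS` §3, «C_shell ≈ 1.5·10³, UNIFORM in R and k»): at each level `k` the shell of the radius-`(R+1)` cube
has at most `6·((4R+4)/b^k + 1)⁴` polymers (anchors `b^k y` in the sup-ball of radius `2R+2`: per coordinate at most `(4R+4)/b^k + 1` block
indices — `card_le_of_mul_near`), each of coefficient `≤ (b^k/(R+2+2b^k))⁴`, and `((4R+4+b^k)/(R+2+2b^k))⁴ ≤ 4⁴`; hence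
**`sum_influenceCoeff_level_le`** `Σ_{γ ∈ shell, γ.k = k} c_γ(x) ≤ 1536`, **`coeffMass_le_levels`** `coeffMass 𝔟 kmax R x ≤ 1536·(kmax+1)`
(`≍ log_b R` at `kmax ≍ log_b R`, R-uniform per level), **`abs_influenceAt_le_levels`**, and the DENSITY BUDGET (iii) of (PL) for
level-dependent activities **`sum_influenceCoeff_mul_level_weight_le`** `Σ_{γ∈shell} c_γ·w(γ.k) ≤ 1536·Σ_{k≤kmax} w k` (`w ≥ 0`) — the `W`
of p527372/p535725/p543486 for any supplier of a multiscale product law with per-level Peierls weights (Bałaban-kind `e^{−p₀(g_k)}` or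
bare-β `δ_k(β, ε_k)`).  HONEST FRAMING: counting only; the multiscale product law itself (levels `k ≥ 1`, block-averaged fields on odd tori)
is OPEN and, on general odd sides, wants cube-centred block lattices (located remark of III); nothing of E0′; not a gap, not Clay.

References: folklore.
-/

set_option autoImplicit false

noncomputable section

open MeasureTheory Filter Topology Finset
open Literature.MathematicalPhysics.QuantumLattice (LGConfig)

namespace Summit.QuantumFields.YangMills.Cruxes.UVSeamRec.PolymerData

/-! ## §1 One-dimensional count: block indices whose scaled value lies in a window -/

/-- **Integers `y` with `|x − m·y| ≤ D` (`m ≥ 1`) number at most `2D/m + 1`**: they form an integer interval of diameter `≤ 2D/m`.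
[folklore] -/
theorem card_le_of_mul_near {m : ℕ} (hm : 1 ≤ m) (x : ℤ) (D : ℕ) (S : Finset ℤ)
    (hS : ∀ y ∈ S, |x - m * y| ≤ D) : (S.card : ℝ) ≤ 2 * (D : ℝ) / m + 1 := by
  rcases S.eq_empty_or_nonempty with hS0 | hne
  · rw [hS0, Finset.card_empty, Nat.cast_zero]
    positivity
  · have hm0 : (0 : ℝ) < m := by exact_mod_cast hm
    set y₀ := S.min' hne with hy₀
    set y₁ := S.max' hne with hy₁
    have hsub : S ⊆ Finset.Icc y₀ y₁ := fun y hy =>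
      Finset.mem_Icc.2 ⟨S.min'_le y hy, S.le_max' y hy⟩
    have hcard : S.card ≤ (y₁ + 1 - y₀).toNat := by
      have h := Finset.card_le_card hsub
      rwa [Int.card_Icc] at h
    have h0 := hS y₀ (S.min'_mem hne)
    have h1 := hS y₁ (S.max'_mem hne)
    have hle : y₀ ≤ y₁ := S.min'_le y₁ (S.max'_mem hne)
    -- `m (y₁ − y₀) ≤ 2D`
    have hdiam : (m : ℤ) * (y₁ - y₀) ≤ 2 * D := by
      have ha := (abs_le.1 h0).2
      have hb := (abs_le.1 h1).1
      nlinarith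
    have hdiamR : ((y₁ - y₀ : ℤ) : ℝ) ≤ 2 * (D : ℝ) / m := by
      rw [le_div_iff₀ hm0]
      have h2 : ((m : ℤ) : ℝ) * ((y₁ - y₀ : ℤ) : ℝ) ≤ ((2 * D : ℤ) : ℝ) := by exact_mod_cast hdiam
      have h3 : ((y₁ - y₀ : ℤ) : ℝ) * (m : ℝ) = ((m : ℤ) : ℝ) * ((y₁ - y₀ : ℤ) : ℝ) := by push_cast; ring
      rw [h3]
      refine h2.trans (le_of_eq ?_)
      push_cast; ring
    have hnn : 0 ≤ y₁ + 1 - y₀ := by linarith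
    calc (S.card : ℝ) ≤ ((y₁ + 1 - y₀).toNat : ℝ) := by exact_mod_cast hcard
      _ = ((y₁ + 1 - y₀ : ℤ) : ℝ) := by
          rw [← Int.toNat_of_nonneg hnn]
          push_cast
          rw [Int.toNat_of_nonneg hnn]
      _ = ((y₁ - y₀ : ℤ) : ℝ) + 1 := by push_cast; ring
      _ ≤ 2 * (D : ℝ) / m + 1 := by linarith

/-! ## §2 The per-level coefficient mass of the shell is at most `1536`, uniformly in `R` and `k` -/

/-- **At most `6·((4R+4)/b^k + 1)⁴` polymers of level `k` in the shell** (anchors `b^k y` within sup-distance `2R+2` of `x`; per coordinate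
`card_le_of_mul_near`; six orientations). [folklore] -/
theorem card_shell_level_le (𝔟 : BlockSize) (kmax R : ℕ) (x : Fin 4 → ℤ) (k : ℕ) :
    (((shell 𝔟 kmax R x).filter (fun γ => γ.k = k)).card : ℝ) ≤
      6 * ((4 * (R : ℝ) + 4) / (𝔟.b : ℝ) ^ k + 1) ^ 4 := by
  classical
  have hor : Fintype.card {q : Fin 4 × Fin 4 // q.1 < q.2} = 6 := by decide
  set T := (shell 𝔟 kmax R x).filter (fun γ => γ.k = k) with hT
  -- block indices and their coordinates
  set Y : Finset (Fin 4 → ℤ) := T.image (fun γ => γ.y) with hY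
  set S : Fin 4 → Finset ℤ := fun i => T.image (fun γ => γ.y i) with hSdef
  have hbk : 1 ≤ 𝔟.b ^ k := Nat.one_le_pow _ _ 𝔟.one_le
  -- the 1-D windows
  have hS : ∀ i, ∀ y ∈ S i, |x i - (𝔟.b ^ k : ℕ) * y| ≤ ((2 * R + 2 : ℕ) : ℤ) := by
    intro i y hy
    rw [hSdef, Finset.mem_image] at hy
    obtain ⟨γ, hγ, rfl⟩ := hy
    rw [hT, Finset.mem_filter] at hγ
    obtain ⟨hγs, hγk⟩ := hγ
    have h1 : ((x i - anchor 𝔟 γ i).natAbs : ℤ) ≤ ((2 * R + 2 : ℕ) : ℤ) := by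
      exact_mod_cast (natAbs_sub_le_supDist x (anchor 𝔟 γ) i).trans (supDist_le_of_mem_shell hγs)
    rw [Int.natCast_natAbs] at h1
    simpa [anchor, hγk] using h1
  have hScard : ∀ i, ((S i).card : ℝ) ≤ 2 * ((2 * R + 2 : ℕ) : ℝ) / ((𝔟.b ^ k : ℕ) : ℝ) + 1 := fun i =>
    card_le_of_mul_near hbk (x i) (2 * R + 2) (S i) (hS i)
  -- `Y ⊆ Π_i S i`
  have hYsub : Y ⊆ Fintype.piFinset S := by
    intro y hy
    rw [Fintype.mem_piFinset]
    intro i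
    rw [hY, Finset.mem_image] at hy
    obtain ⟨γ, hγ, rfl⟩ := hy
    rw [hSdef]
    exact Finset.mem_image.2 ⟨γ, hγ, rfl⟩
  have hYcard : (Y.card : ℝ) ≤ ((4 * (R : ℝ) + 4) / (𝔟.b : ℝ) ^ k + 1) ^ 4 := by
    have h1 : Y.card ≤ ∏ i, (S i).card := by
      rw [← Fintype.card_piFinset]; exact Finset.card_le_card hYsub
    have h2 : (Y.card : ℝ) ≤ ∏ i, ((S i).card : ℝ) := by exact_mod_cast h1
    refine h2.trans ?_
    have h3 : ∏ i : Fin 4, ((S i).card : ℝ) ≤ ∏ _i : Fin 4, ((4 * (R : ℝ) + 4) / (𝔟.b : ℝ) ^ k + 1) := by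
      refine Finset.prod_le_prod (fun i _ => Nat.cast_nonneg _) fun i _ => ?_
      refine (hScard i).trans (le_of_eq ?_)
      push_cast
      ring
    rw [Finset.prod_const, Finset.card_univ, Fintype.card_fin] at h3
    exact h3
  -- `T` injects into `Y × orientations`
  have hTcard : T.card ≤ (Y ×ˢ (Finset.univ : Finset {q : Fin 4 × Fin 4 // q.1 < q.2})).card := by
    refine Finset.card_le_card_of_injOn (fun γ => (γ.y, (⟨(γ.μ, γ.ν), γ.hμν⟩ : {q : Fin 4 × Fin 4 // q.1 < q.2})))
      (fun γ hγ => Finset.mem_product.2 ⟨Finset.mem_image.2 ⟨γ, hγ, rfl⟩, Finset.mem_univ _⟩) ?_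
    rintro ⟨k₁, y₁, μ₁, ν₁, h₁⟩ hγ₁ ⟨k₂, y₂, μ₂, ν₂, h₂⟩ hγ₂ heq
    simp only [Prod.mk.injEq, Subtype.mk.injEq] at heq
    obtain ⟨rfl, rfl, rfl⟩ := heq
    have hk₁ : k₁ = k := (Finset.mem_filter.1 (Finset.mem_coe.1 hγ₁)).2
    have hk₂ : k₂ = k := (Finset.mem_filter.1 (Finset.mem_coe.1 hγ₂)).2
    subst hk₁; subst hk₂
    rfl
  calc (T.card : ℝ) ≤ ((Y ×ˢ (Finset.univ : Finset {q : Fin 4 × Fin 4 // q.1 < q.2})).card : ℝ) := by exact_mod_cast hTcard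
    _ = (Y.card : ℝ) * 6 := by rw [Finset.card_product, Finset.card_univ, hor]; push_cast; ring
    _ ≤ ((4 * (R : ℝ) + 4) / (𝔟.b : ℝ) ^ k + 1) ^ 4 * 6 := by gcongr
    _ = 6 * ((4 * (R : ℝ) + 4) / (𝔟.b : ℝ) ^ k + 1) ^ 4 := by ring

/-- A level-`k` shell coefficient is `≤ (b^k/(R+2+2b^k))⁴`. [folklore] -/
theorem influenceCoeff_le_of_mem_shell_level {𝔟 : BlockSize} {kmax R : ℕ} {x : Fin 4 → ℤ} {γ : Polymer}
    (h : γ ∈ shell 𝔟 kmax R x) :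
    influenceCoeff 𝔟 γ x ≤ ((𝔟.b : ℝ) ^ γ.k / ((R : ℝ) + 2 + 2 * (𝔟.b : ℝ) ^ γ.k)) ^ 4 := by
  have hd := le_supDist_of_mem_shell h
  have hd' : (R : ℝ) + 2 + 2 * (𝔟.b : ℝ) ^ γ.k ≤ (supDist x (anchor 𝔟 γ) : ℝ) := by
    have : ((R + 2 + 2 * 𝔟.b ^ γ.k : ℕ) : ℝ) ≤ (supDist x (anchor 𝔟 γ) : ℝ) := by exact_mod_cast hd
    push_cast at this
    exact this
  have hbk : (0 : ℝ) < (𝔟.b : ℝ) ^ γ.k := by have := 𝔟.pos; positivity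
  have hden : (0 : ℝ) < (R : ℝ) + 2 + 2 * (𝔟.b : ℝ) ^ γ.k := by positivity
  unfold influenceCoeff
  exact pow_le_pow_left₀ (by positivity) (div_le_div_of_nonneg_left hbk.le hden hd') 4

/-- **THE PER-LEVEL COEFFICIENT MASS OF THE SHELL IS AT MOST `1536 = 6·4⁴`, UNIFORMLY IN THE RADIUS AND THE LEVEL**:
`Σ_{γ ∈ shell, γ.k = k} (b^k/dist)⁴ ≤ 6·((4R+4)/b^k + 1)⁴·(b^k/(R+2+2b^k))⁴ = 6·((4R+4+b^k)/(R+2+2b^k))⁴ ≤ 6·4⁴` — the scale invariance of the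
dimension-4 weight: a dyadic-type shell carries `O(1)` influence per scale (ceilings-p2 g2's `C_shell`, note §3, kernel-checked). [folklore] -/
theorem sum_influenceCoeff_level_le (𝔟 : BlockSize) (kmax R : ℕ) (x : Fin 4 → ℤ) (k : ℕ) :
    ∑ γ ∈ (shell 𝔟 kmax R x).filter (fun γ => γ.k = k), influenceCoeff 𝔟 γ x ≤ 1536 := by
  classical
  have hb : (0 : ℝ) < (𝔟.b : ℝ) := by exact_mod_cast 𝔟.pos
  have hbk : (0 : ℝ) < (𝔟.b : ℝ) ^ k := by positivity
  have hden : (0 : ℝ) < (R : ℝ) + 2 + 2 * (𝔟.b : ℝ) ^ k := by positivity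
  set cmax : ℝ := ((𝔟.b : ℝ) ^ k / ((R : ℝ) + 2 + 2 * (𝔟.b : ℝ) ^ k)) ^ 4 with hcmax
  have hterm : ∀ γ ∈ (shell 𝔟 kmax R x).filter (fun γ => γ.k = k), influenceCoeff 𝔟 γ x ≤ cmax := by
    intro γ hγ
    obtain ⟨hγs, hγk⟩ := Finset.mem_filter.1 hγ
    have h := influenceCoeff_le_of_mem_shell_level hγs
    rw [hγk] at h
    exact h
  calc ∑ γ ∈ (shell 𝔟 kmax R x).filter (fun γ => γ.k = k), influenceCoeff 𝔟 γ x
      ≤ ∑ _γ ∈ (shell 𝔟 kmax R x).filter (fun γ => γ.k = k), cmax := Finset.sum_le_sum hterm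
    _ = (((shell 𝔟 kmax R x).filter (fun γ => γ.k = k)).card : ℝ) * cmax := by rw [Finset.sum_const, nsmul_eq_mul]
    _ ≤ 6 * ((4 * (R : ℝ) + 4) / (𝔟.b : ℝ) ^ k + 1) ^ 4 * cmax :=
        mul_le_mul_of_nonneg_right (card_shell_level_le 𝔟 kmax R x k) (by positivity)
    _ = 6 * (((4 * (R : ℝ) + 4) / (𝔟.b : ℝ) ^ k + 1) * ((𝔟.b : ℝ) ^ k / ((R : ℝ) + 2 + 2 * (𝔟.b : ℝ) ^ k))) ^ 4 := by
        rw [hcmax]; ring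
    _ = 6 * ((4 * (R : ℝ) + 4 + (𝔟.b : ℝ) ^ k) / ((R : ℝ) + 2 + 2 * (𝔟.b : ℝ) ^ k)) ^ 4 := by
        congr 2
        field_simp
    _ ≤ 6 * (4 : ℝ) ^ 4 := by
        have hq : (4 * (R : ℝ) + 4 + (𝔟.b : ℝ) ^ k) / ((R : ℝ) + 2 + 2 * (𝔟.b : ℝ) ^ k) ≤ 4 := by
          rw [div_le_iff₀ hden]; nlinarith
        have hq0 : 0 ≤ (4 * (R : ℝ) + 4 + (𝔟.b : ℝ) ^ k) / ((R : ℝ) + 2 + 2 * (𝔟.b : ℝ) ^ k) := by positivity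
        gcongr
    _ = 1536 := by norm_num

/-- **`coeffMass 𝔟 kmax R x ≤ 1536·(kmax+1)`, uniformly in `R` and `x`** (sum the per-level bound over the levels `0,…,kmax`; at the
cutoff `kmax ≍ log_b R` of the architecture this is the `≍ log R` sup of the influence functional — harmless for (RM), where only the density
budget enters). [folklore] -/
theorem coeffMass_le_levels (𝔟 : BlockSize) (kmax R : ℕ) (x : Fin 4 → ℤ) :
    coeffMass 𝔟 kmax R x ≤ 1536 * ((kmax : ℝ) + 1) := by
  classical
  have hmaps : ∀ γ ∈ shell 𝔟 kmax R x, γ.k ∈ Finset.range (kmax + 1) := fun γ hγ =>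
    Finset.mem_range.2 (Nat.lt_succ_of_le (level_le_of_mem_shell hγ))
  unfold coeffMass
  rw [← Finset.sum_fiberwise_of_maps_to hmaps]
  calc ∑ k ∈ Finset.range (kmax + 1), ∑ γ ∈ (shell 𝔟 kmax R x).filter (fun γ => γ.k = k), influenceCoeff 𝔟 γ x
      ≤ ∑ _k ∈ Finset.range (kmax + 1), (1536 : ℝ) := Finset.sum_le_sum fun k _ => sum_influenceCoeff_level_le 𝔟 kmax R x k
    _ = 1536 * ((kmax : ℝ) + 1) := by
        rw [Finset.sum_const, Finset.card_range, nsmul_eq_mul]; push_cast; ring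

/-- `|influenceAt 𝔟 ε kmax β R q x η| ≤ 1536·(kmax β R + 1)` — an `R`-uniform-per-level bound `MY β R` for the carrier hypothesis `hYb`
(sharper than III's `abs_influenceAt_le_influenceBound` whenever `kmax` is logarithmic in `R`). [folklore] -/
theorem abs_influenceAt_le_levels {N : ℕ} [NeZero N] (𝔟 : BlockSize) (ε : ℝ → ℕ → ℝ) (kmax : ℝ → ℕ → ℕ) (β : ℝ) (R : ℕ)
    (q : Fin 4 × Fin 4) (x : Fin 4 → ℤ) (η : LGConfig 4 (Matrix.specialUnitaryGroup (Fin N) ℂ)) :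
    |influenceAt (N := N) 𝔟 ε kmax β R q x η| ≤ 1536 * ((kmax β R : ℝ) + 1) :=
  (abs_influenceAt_le 𝔟 ε kmax β R q x η).trans (coeffMass_le_levels 𝔟 (kmax β R) R x)

/-- **THE DENSITY BUDGET (iii) OF (PL) FOR LEVEL-DEPENDENT ACTIVITIES**: for weights `w k ≥ 0` depending only on the level,
`Σ_{γ ∈ shell} c_γ(x)·w(γ.k) ≤ 1536·Σ_{k ≤ kmax} w k` — the `W` of ceilings-p2's `torusE_exp_two_mul_sum_le_of_polymerLaw` /
`responseMoments_of_quadratic_and_influence` (p543486) for any supplier of a multiscale product law with per-level Peierls weights, β-uniform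
exactly when `Σ_{k ≤ kmax β R} w_k(β)` is (note §3: Bałaban-kind weights are dominated by the top levels). [folklore] -/
theorem sum_influenceCoeff_mul_level_weight_le (𝔟 : BlockSize) (kmax R : ℕ) (x : Fin 4 → ℤ) (w : ℕ → ℝ) (hw : ∀ k, 0 ≤ w k) :
    ∑ γ ∈ shell 𝔟 kmax R x, influenceCoeff 𝔟 γ x * w γ.k ≤ 1536 * ∑ k ∈ Finset.range (kmax + 1), w k := by
  classical
  have hmaps : ∀ γ ∈ shell 𝔟 kmax R x, γ.k ∈ Finset.range (kmax + 1) := fun γ hγ =>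
    Finset.mem_range.2 (Nat.lt_succ_of_le (level_le_of_mem_shell hγ))
  rw [← Finset.sum_fiberwise_of_maps_to hmaps, Finset.mul_sum]
  refine Finset.sum_le_sum fun k _ => ?_
  calc ∑ γ ∈ (shell 𝔟 kmax R x).filter (fun γ => γ.k = k), influenceCoeff 𝔟 γ x * w γ.k
      = (∑ γ ∈ (shell 𝔟 kmax R x).filter (fun γ => γ.k = k), influenceCoeff 𝔟 γ x) * w k := by
        rw [Finset.sum_mul]
        refine Finset.sum_congr rfl fun γ hγ => ?_
        rw [(Finset.mem_filter.1 hγ).2]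
    _ ≤ 1536 * w k := mul_le_mul_of_nonneg_right (sum_influenceCoeff_level_le 𝔟 kmax R x k) (hw k)

/-- The same budget in the family letters of p528131/p543486: `Σ_{γ ∈ familyShell} familyCoeff i γ · w(γ.k) ≤ 1536·Σ_{k≤kmax} w k` for
every cube `i` of the family. [folklore] -/
theorem sum_familyCoeff_mul_level_weight_le (𝔟 : BlockSize) (kmax R : ℕ) {n : ℕ} (x : Fin n → (Fin 4 → ℤ)) (i : Fin n)
    (w : ℕ → ℝ) (hw : ∀ k, 0 ≤ w k) :
    ∑ γ ∈ familyShell 𝔟 kmax R x, familyCoeff 𝔟 kmax R x i γ * w γ.k ≤ 1536 * ∑ k ∈ Finset.range (kmax + 1), w k := by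
  classical
  have hsub := shell_subset_familyShell 𝔟 kmax R x i
  have hzero : ∀ γ ∈ familyShell 𝔟 kmax R x, γ ∉ shell 𝔟 kmax R (x i) →
      familyCoeff 𝔟 kmax R x i γ * w γ.k = 0 := fun γ _ hγ => by
    rw [familyCoeff, if_neg hγ, zero_mul]
  rw [← Finset.sum_subset hsub hzero]
  calc ∑ γ ∈ shell 𝔟 kmax R (x i), familyCoeff 𝔟 kmax R x i γ * w γ.k
      = ∑ γ ∈ shell 𝔟 kmax R (x i), influenceCoeff 𝔟 γ (x i) * w γ.k :=
        Finset.sum_congr rfl fun γ hγ => by rw [familyCoeff, if_pos hγ]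
    _ ≤ 1536 * ∑ k ∈ Finset.range (kmax + 1), w k := sum_influenceCoeff_mul_level_weight_le 𝔟 kmax R (x i) w hw

end Summit.QuantumFields.YangMills.Cruxes.UVSeamRec.PolymerData

end
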